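import Mathlib.Analysis.SpecialFunctions.Sqrt
import Mathlib.Analysis.InnerProductSpace.Calculus
import Mathlib.Topology.OpenPartialHomeomorph.Basic
import Literature.Topology.FourManifolds.RadialDiffeomorph
import Literature.Geometry.Lorentzian.NearKerrLeaf
import Literature.Geometry.Lorentzian.LateChartDilation
import HarnessLib

/-!
# Stub `stub_phantom` of line `Sketch` of crux `Capture` (stmt-FinalStateConjecture-10115):
# the phantom hole

The crux `Capture` (routes `BartnikGapSettling` / `QuietWindowCapture`, summit
`FinalStateConjecture`) is stated over `CauchyDevelopment.IsNearKerrLeaf 𝒟 k ε N M a S`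
(`Literature/Geometry/Lorentzian/NearKerrLeaf.lean`: `N` hole charts on boosted Kerr star regions,
one flat hyperboloidal chart, twenty clauses).  This file proves the registered stub `stub_phantom`
of `Summits/FinalStateConjecture/FinalStateConjecture/Cruxes/Capture/Lines/Sketch.lean` (PHANTOM
HOLE): a `0`-hole `(ε, k)`-near-Kerr leaf `S` is a `1`-hole `(ε, k)`-near-Kerr leaf with the
Schwarzschild label `(M', 0)` for EVERY `M' > 0` (same `S`): labels are upper information only.

Construction.  Keep the flat chart `Ψ₀ : U₀ → 𝒟` and all its clauses.  The phantom hole has the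
trivial motion `(1, 0)`, so its star background is `{M' < |y̲|}` with time `y⁰` and radius `|y̲|`
(`Kerr.radius 0 = |·̲|`); take truncation radius `R := M'` and overlap radius `ρ := M'/2`.  Then
the disc `{t* = 0, r ≤ R}`, the upper layer `{0 < t* < 1, r ≤ R}` and the inner overlap annulus
`{t* = 0, ρ < r ≤ R}` are EMPTY in the star domain `{r > M'}`: the deviation clause
(`supCkENorm ∅ = 0`), disjointness (`Fin 1` is a subsingleton), the first overlap clause and the
three clauses on `S`, `I⁺(S)`, the barrier (unions of `∅` over `Fin 1`, as over `Fin 0`) are free,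
and the `U₀`-containment clause only gains a hypothesis.  The one real duty of the phantom chart is
to be a smooth open embedding of its layer `L₁ = {−1 < y⁰ < 1, M' < |y̲| < M' + 1}` into `J⁺(ι X)`
swallowing the cap `Ψ₀ {t₀ = 0, M'/2 < |x̲| < M'}` of the hyperboloid (second overlap clause).
We put `Ψ₁ := Ψ₀ ∘ Φ`, `Φ (y⁰, y̲) = (y⁰ + √(1 + |φ y̲|²), φ y̲)` the BENDING MAP, `φ` the radial
map (`Literature.Topology.FourManifolds.radialMap`) of affine profile `p s = M'/4 + M' (s − M')`
(shell `(M', M'+1)` onto `(M'/4, 5M'/4)`); the hyperboloidal time of `Φ y` is `y⁰ ∈ (−1, 1)`, so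
`Φ(L₁) ⊆ {t₀ > −1} ⊆ U₀` and `Φ(L₁) ⊆ L₀`.  `Φ` is packaged as an `OpenPartialHomeomorph` of `E4`
with inverse `(x⁰, x̲) ↦ (t₀ x, ψ x̲)`, `ψ` radial of profile `q u = M' + (u − M'/4)/M'`
(`exists_bend`; smoothness off the time axis by `contDiffAt_radialMap` and `ContDiffAt.sqrt`).
Smoothness of `Ψ₁` on `L₁` is `ContMDiffOn.comp`; the open embedding of `L₁` is the flat chart's
open embedding of `L₀` after the open embedding `L₁ → L₀` induced by `Φ`
(`OpenPartialHomeomorph.isOpenEmbedding_restrict`, `IsOpenEmbedding.of_comp` against inclusions of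
open subtypes); the cap is covered since `Φ⁻¹ x ∈ L₁` there (`|ψ x̲| ∈ (M' + 1/4, M' + 3/4)`).

No named facts, no definitions: the explicit maps are `∃`-witnesses inside the proofs, their
generic calculus is §1.  References: Dafermos–Holzegel–Rodnianski–Taylor arXiv:2104.08222, §1
(leaf vocabulary); Dafermos–Rodnianski arXiv:0811.0354, §5.1 (Kerr-star coordinates); the
hyperboloids `{x⁰ − √(1 + |x̲|²) = τ}` of Minkowski space are folklore.
-/

-- the doubled `FinalStateConjecture.FinalStateConjecture` path component trips dupNamespace
set_option linter.dupNamespace false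

noncomputable section

namespace Summit.FinalStateConjecture.FinalStateConjecture.Theorems.BartnikGapSettling.Capture

open Set Filter Topology TopologicalSpace
open scoped Manifold ContDiff ENNReal
open Literature.Geometry.Lorentzian
open Literature.Topology.FourManifolds (radialMap norm_radialMap radialMap_radialMap
  contDiffAt_radialMap)

/-! ### §1 The bending map `(y⁰, y̲) ↦ (y⁰ + √(1 + |φ y̲|²), φ y̲)` and its inverse -/

section Bend

variable {p q : ℝ → ℝ} {F G : E4 → E4}
  (hF : ∀ y, F y = E4.ofTimeSpace (y 0 + √(1 + ‖radialMap p (E4.spatial y)‖ ^ 2))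
    (radialMap p (E4.spatial y)))
  (hG : ∀ x, G x = E4.ofTimeSpace (x 0 - √(1 + E4.spatialNorm x ^ 2))
    (radialMap q (E4.spatial x)))

include hF in
/-- The bending map `F (y⁰, y̲) = (y⁰ + √(1 + |φ y̲|²), φ y̲)` has hyperboloidal time `y⁰`:
`(F y)⁰ − √(1 + |F y̲|²) = y⁰`. [folklore] -/
private theorem time_bend (y : E4) : F y 0 - √(1 + E4.spatialNorm (F y) ^ 2) = y 0 := by
  rw [hF, E4.ofTimeSpace_apply_zero, E4.spatialNorm_ofTimeSpace]
  ring

include hF in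
/-- The spatial part of the bending map is the radial map `φ = radialMap p`. [folklore] -/
private theorem spatial_bend (y : E4) : E4.spatial (F y) = radialMap p (E4.spatial y) := by
  rw [hF, E4.spatial_ofTimeSpace]

include hF in
/-- Off the time axis the spatial radius of the bending map is `|p |y̲||`. [folklore] -/
private theorem spatialNorm_bend {y : E4} (hy : E4.spatial y ≠ 0) :
    E4.spatialNorm (F y) = |p (E4.spatialNorm y)| := by
  simp only [E4.spatialNorm]
  rw [spatial_bend hF, norm_radialMap p hy]

include hG in
/-- The time coordinate of the unbending map `G (x⁰, x̲) = (t₀ x, ψ x̲)` is `t₀ x`. [folklore] -/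
private theorem time_unbend (x : E4) : G x 0 = x 0 - √(1 + E4.spatialNorm x ^ 2) := by
  rw [hG, E4.ofTimeSpace_apply_zero]

include hG in
/-- The spatial part of the unbending map is the radial map `ψ = radialMap q`. [folklore] -/
private theorem spatial_unbend (x : E4) : E4.spatial (G x) = radialMap q (E4.spatial x) := by
  rw [hG, E4.spatial_ofTimeSpace]

include hG in
/-- Off the time axis the spatial radius of the unbending map is `|q |x̲||`. [folklore] -/
private theorem spatialNorm_unbend {x : E4} (hx : E4.spatial x ≠ 0) :
    E4.spatialNorm (G x) = |q (E4.spatialNorm x)| := by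
  simp only [E4.spatialNorm]
  rw [spatial_unbend hG, norm_radialMap q hx]

include hF hG in
/-- `G ∘ F = id` off the time axis, where `p |y̲| > 0` and `q (p |y̲|) = |y̲|`. [folklore] -/
private theorem unbend_bend {y : E4} (hy : E4.spatial y ≠ 0) (hp : 0 < p ‖E4.spatial y‖)
    (hqp : q (p ‖E4.spatial y‖) = ‖E4.spatial y‖) : G (F y) = y := by
  rw [hG, time_bend hF, spatial_bend hF, radialMap_radialMap q p hy hp, hqp,
    mul_inv_cancel₀ (norm_ne_zero_iff.2 hy), one_smul]
  exact E4.ofTimeSpace_time_spatial y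

include hF hG in
/-- `F ∘ G = id` off the time axis, where `q |x̲| > 0` and `p (q |x̲|) = |x̲|`. [folklore] -/
private theorem bend_unbend {x : E4} (hx : E4.spatial x ≠ 0) (hq : 0 < q ‖E4.spatial x‖)
    (hpq : p (q ‖E4.spatial x‖) = ‖E4.spatial x‖) : F (G x) = x := by
  rw [hF, spatial_unbend hG, time_unbend hG, radialMap_radialMap p q hx hq, hpq,
    mul_inv_cancel₀ (norm_ne_zero_iff.2 hx), one_smul, E4.spatialNorm, sub_add_cancel]
  exact E4.ofTimeSpace_time_spatial x

include hF in
/-- The bending map is smooth off the time axis when its profile is smooth at `|y̲|` (the norm is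
smooth off `0`, `contDiffAt_radialMap`; `√` is smooth on `(0, ∞)`). [folklore] -/
private theorem contDiffAt_bend {y : E4} (hy : E4.spatial y ≠ 0)
    (hp : ContDiffAt ℝ ∞ p ‖E4.spatial y‖) : ContDiffAt ℝ ∞ F y := by
  have hφ : ContDiffAt ℝ ∞ (fun x : E4 => radialMap p (E4.spatial x)) y :=
    (contDiffAt_radialMap hy hp).comp y E4.spatial.contDiff.contDiffAt
  have h0 : ContDiffAt ℝ ∞ (fun x : E4 => x 0) y := by fun_prop
  have hs : ContDiffAt ℝ ∞ (fun x : E4 => x 0 + √(1 + ‖radialMap p (E4.spatial x)‖ ^ 2)) y :=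
    h0.add ((contDiffAt_const.add (hφ.norm_sq ℝ)).sqrt (by positivity))
  rw [contDiffAt_euclidean]
  refine Fin.cases ?_ (fun j => ?_)
  · simp only [hF, E4.ofTimeSpace_apply_zero]
    exact hs
  · simp only [hF, E4.ofTimeSpace_apply_succ]
    exact contDiffAt_euclidean.1 hφ j

include hG in
/-- The unbending map is smooth off the time axis if its profile is smooth at `|x̲|`. [folklore] -/
private theorem contDiffAt_unbend {x : E4} (hx : E4.spatial x ≠ 0)
    (hq : ContDiffAt ℝ ∞ q ‖E4.spatial x‖) : ContDiffAt ℝ ∞ G x := by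
  have hψ : ContDiffAt ℝ ∞ (fun x : E4 => radialMap q (E4.spatial x)) x :=
    (contDiffAt_radialMap hx hq).comp x E4.spatial.contDiff.contDiffAt
  have h0 : ContDiffAt ℝ ∞ (fun x : E4 => x 0) x := by fun_prop
  have hs : ContDiffAt ℝ ∞ (fun x : E4 => x 0 - √(1 + E4.spatialNorm x ^ 2)) x := by
    simp only [E4.spatialNorm]
    exact h0.sub ((contDiffAt_const.add (E4.spatial.contDiff.contDiffAt.norm_sq ℝ)).sqrt
      (by positivity))
  rw [contDiffAt_euclidean]
  refine Fin.cases ?_ (fun j => ?_)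
  · simp only [hG, E4.ofTimeSpace_apply_zero]
    exact hs
  · simp only [hG, E4.ofTimeSpace_apply_succ]
    exact contDiffAt_euclidean.1 hψ j

end Bend

/-- **The bending partial homeomorphism.** For `M' > 0` there is an open partial homeomorphism
`e` of `E4` with source the slab-shell `{−1 < y⁰ < 1, M' < |y̲| < M' + 1}`, smooth on its source,
with hyperboloidal time `t₀(e y) = y⁰`, whose target contains the cap `{t₀ = 0, M'/2 < |x̲| < M'}`:
`e (y⁰, y̲) = (y⁰ + √(1 + |φ y̲|²), φ y̲)`, `φ` radial of profile `p s = M'/4 + M'(s − M')` (shell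
`(M', M'+1)` onto `(M'/4, 5M'/4)`), inverse `(x⁰, x̲) ↦ (t₀ x, ψ x̲)`, `ψ` radial of profile
`q u = M' + (u − M'/4)/M'`. [folklore] -/
private theorem exists_bend {M' : ℝ} (hM' : 0 < M') : ∃ e : OpenPartialHomeomorph E4 E4,
    (∀ y, y ∈ e.source ↔
      -1 < y 0 ∧ y 0 < 1 ∧ M' < E4.spatialNorm y ∧ E4.spatialNorm y < M' + 1) ∧
    (∀ y, e y 0 - √(1 + E4.spatialNorm (e y) ^ 2) = y 0) ∧
    (∀ y ∈ e.source, ContDiffAt ℝ ∞ e y) ∧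
    ∀ x : E4, x 0 - √(1 + E4.spatialNorm x ^ 2) = 0 → M' / 2 < E4.spatialNorm x →
      E4.spatialNorm x < M' → x ∈ e.target := by
  have hM0 : M' ≠ 0 := hM'.ne'
  -- the two radial profiles
  obtain ⟨p, hp⟩ : ∃ p : ℝ → ℝ, ∀ s, p s = M' / 4 + M' * (s - M') := ⟨_, fun _ => rfl⟩
  obtain ⟨q, hq⟩ : ∃ q : ℝ → ℝ, ∀ u, q u = M' + (u - M' / 4) / M' := ⟨_, fun _ => rfl⟩
  have hqp : ∀ s, q (p s) = s := fun s => by rw [hq, hp]; field_simp; ring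
  have hpq : ∀ u, p (q u) = u := fun u => by rw [hp, hq]; field_simp; ring
  have hp_gt : ∀ s, M' < s → M' / 4 < p s := fun s hs => by
    rw [hp]; nlinarith [mul_pos hM' (sub_pos.2 hs)]
  have hp_lt : ∀ s, s < M' + 1 → p s < 5 * M' / 4 := fun s hs => by
    rw [hp]; nlinarith [mul_lt_mul_of_pos_left (show s - M' < 1 by linarith) hM']
  have hq_gt : ∀ u, M' / 4 < u → M' < q u := fun u hu => by
    rw [hq]; linarith [div_pos (show 0 < u - M' / 4 by linarith) hM']
  have hq_lt : ∀ u, u < 5 * M' / 4 → q u < M' + 1 := fun u hu => by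
    rw [hq]; linarith [(div_lt_one hM').2 (show u - M' / 4 < M' by linarith)]
  have hpc : ContDiff ℝ ∞ p := by rw [funext hp]; fun_prop
  have hqc : ContDiff ℝ ∞ q := by rw [funext hq]; fun_prop
  -- the bending map and its inverse
  obtain ⟨F, hF⟩ : ∃ F : E4 → E4, ∀ y, F y =
      E4.ofTimeSpace (y 0 + √(1 + ‖radialMap p (E4.spatial y)‖ ^ 2))
        (radialMap p (E4.spatial y)) := ⟨_, fun _ => rfl⟩
  obtain ⟨G, hG⟩ : ∃ G : E4 → E4, ∀ x, G x =
      E4.ofTimeSpace (x 0 - √(1 + E4.spatialNorm x ^ 2)) (radialMap q (E4.spatial x)) :=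
    ⟨_, fun _ => rfl⟩
  have h0c : Continuous fun x : E4 => x 0 := by fun_prop
  have hsNc : Continuous E4.spatialNorm := E4.spatial.continuous.norm
  have ht₀c : Continuous fun x : E4 => x 0 - √(1 + E4.spatialNorm x ^ 2) := by
    unfold E4.spatialNorm; fun_prop
  have hne : ∀ y : E4, M' / 4 < E4.spatialNorm y → E4.spatial y ≠ 0 := fun y hy h => by
    rw [E4.spatialNorm, h, norm_zero] at hy; linarith
  refine
    ⟨{toFun := F
      invFun := G
      source := {y | -1 < y 0 ∧ y 0 < 1 ∧ M' < E4.spatialNorm y ∧ E4.spatialNorm y < M' + 1}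
      target := {x | -1 < x 0 - √(1 + E4.spatialNorm x ^ 2) ∧
        x 0 - √(1 + E4.spatialNorm x ^ 2) < 1 ∧
          M' / 4 < E4.spatialNorm x ∧ E4.spatialNorm x < 5 * M' / 4}
      map_source' := ?_
      map_target' := ?_
      left_inv' := ?_
      right_inv' := ?_
      continuousOn_toFun := ?_
      continuousOn_invFun := ?_
      open_source := ?_
      open_target := ?_ },
      fun y => Iff.rfl, fun y => time_bend hF y, fun y hy => ?_, fun x h0 h1 h2 => ?_⟩
  · rintro y ⟨h1, h2, h3, h4⟩
    have hy := hne y (by linarith)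
    have hpos : 0 < p (E4.spatialNorm y) := lt_trans (by positivity) (hp_gt _ h3)
    refine ⟨by rw [time_bend hF]; exact h1, by rw [time_bend hF]; exact h2, ?_, ?_⟩
    · rw [spatialNorm_bend hF hy, abs_of_pos hpos]
      exact hp_gt _ h3
    · rw [spatialNorm_bend hF hy, abs_of_pos hpos]
      exact hp_lt _ h4
  · rintro x ⟨h1, h2, h3, h4⟩
    have hx := hne x h3
    have hpos : 0 < q (E4.spatialNorm x) := hM'.trans (hq_gt _ h3)
    refine ⟨by rw [time_unbend hG]; exact h1, by rw [time_unbend hG]; exact h2, ?_, ?_⟩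
    · rw [spatialNorm_unbend hG hx, abs_of_pos hpos]
      exact hq_gt _ h3
    · rw [spatialNorm_unbend hG hx, abs_of_pos hpos]
      exact hq_lt _ h4
  · rintro y ⟨-, -, h3, -⟩
    exact unbend_bend hF hG (hne y (by linarith)) (lt_trans (by positivity) (hp_gt _ h3)) (hqp _)
  · rintro x ⟨-, -, h3, -⟩
    exact bend_unbend hF hG (hne x h3) (hM'.trans (hq_gt _ h3)) (hpq _)
  · rintro y ⟨-, -, h3, -⟩
    exact (contDiffAt_bend hF (hne y (by linarith)) hpc.contDiffAt).continuousAt.continuousWithinAt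
  · rintro x ⟨-, -, h3, -⟩
    exact (contDiffAt_unbend hG (hne x h3) hqc.contDiffAt).continuousAt.continuousWithinAt
  · exact (isOpen_lt continuous_const h0c).and ((isOpen_lt h0c continuous_const).and
      ((isOpen_lt continuous_const hsNc).and (isOpen_lt hsNc continuous_const)))
  · exact (isOpen_lt continuous_const ht₀c).and ((isOpen_lt ht₀c continuous_const).and
      ((isOpen_lt continuous_const hsNc).and (isOpen_lt hsNc continuous_const)))
  · obtain ⟨-, -, h3, -⟩ := hy
    exact contDiffAt_bend hF (hne y (by linarith)) hpc.contDiffAt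
  · exact ⟨by rw [h0]; norm_num, by rw [h0]; norm_num, by linarith, by linarith⟩

/-- `poincareInv 1 0 = id`: the trivial motion (O'Neill 1983, Ch. 9, p. 236). [folklore] -/
private theorem poincareInv_one_zero' (x : E4) : poincareInv 1 0 x = x := by
  rw [poincareInv, sub_zero]
  rfl

/-! ### §2 The phantom hole -/

/-- **The phantom hole** (stub `stub_phantom` of line `Sketch`, crux `Capture`,
stmt-FinalStateConjecture-10115): every `0`-hole `(ε, k)`-near-Kerr leaf `S` of a Cauchy
development is a `1`-hole `(ε, k)`-near-Kerr leaf with the Schwarzschild label `(M', 0)`, for every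
`M' > 0`, with the same `S`.  The phantom hole has the trivial motion, truncation radius `R = M'`
(so its disc `{t* = 0, r ≤ M'}` is empty in the star domain `{r > M'}` and all metric duties are
vacuous), overlap radius `M'/2`, and chart `Ψ₀ ∘ Φ` with `Φ` the bending map of `exists_bend`,
which charts the cap `Ψ₀ {t₀ = 0, M'/2 < |x̲| < M'}` of the hyperboloidal leaf. [folklore] -/
theorem stub_phantom :
    ∀ (X : Type) [TopologicalSpace X] [ChartedSpace E3 X] [IsManifold (𝓡 3) ∞ X] [ConnectedSpace X]
      (D : InitialDataSet (𝓡 3) X) (𝒟 : CauchyDevelopment D) (k : ℕ) (ε : ℝ≥0∞) (M a : Fin 0 → ℝ)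
      (S : Set 𝒟.carrier) (M' : ℝ), 0 < M' →
      𝒟.IsNearKerrLeaf k ε 0 M a S → 𝒟.IsNearKerrLeaf k ε 1 (fun _ ↦ M') (fun _ ↦ 0) S := by
  intro X _ _ _ _ D 𝒟 k ε M a S M' hM' h
  obtain ⟨R, ρ, mo, r, B, U₀, B₀, Ψ, Ψ₀, L, W, L₀, W₀, -, -, hB₀, -, hL₀, hW₀, -, hU₀, -,
    hΨ₀, hΨ₀e, hΨ₀J, -, hdev₀, -, -, -, hS, hWI, hbar⟩ := h
  subst hB₀
  rw [iUnion_of_empty, union_empty] at hS hWI hbar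
  /- 1. The flat chart: `U₀ ⊇ {t₀ > -1}`, the layer `L₀ = {-1 < t₀ < 1}` is open, a junk point of
  `U₀`, and the extension-by-junk `π : E4 → U₀` of the identity of `U₀`. -/
  have hU₀' : ∀ x : E4, -1 < x 0 - √(1 + E4.spatialNorm x ^ 2) → x ∈ (U₀ : Set E4) :=
    fun x hx ↦ hU₀ ⟨hx, fun i ↦ i.elim0⟩
  have ht₀c : Continuous fun x : E4 ↦ x 0 - √(1 + E4.spatialNorm x ^ 2) := by
    unfold E4.spatialNorm; fun_prop
  have hL₀o : IsOpen L₀ := by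
    rw [hL₀]
    simp only [hypBackground_time]
    exact (isOpen_lt continuous_const (ht₀c.comp continuous_subtype_val)).and
      (isOpen_lt (ht₀c.comp continuous_subtype_val) continuous_const)
  have hx₀ : E4.ofTimeSpace 2 0 ∈ (U₀ : Set E4) := hU₀' _ (by norm_num)
  obtain ⟨π, hπ⟩ : ∃ π : E4 → (hypBackground U₀).domain,
      ∀ (x : E4) (hx : x ∈ (U₀ : Set E4)), π x = ⟨x, hx⟩ := by
    classical
    exact ⟨fun x ↦ if hx : x ∈ (U₀ : Set E4) then ⟨x, hx⟩ else ⟨_, hx₀⟩, fun x hx ↦ dif_pos hx⟩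
  /- 2. The bending partial homeomorphism. -/
  obtain ⟨e, hsrc, htime, hsmooth, htgt⟩ := exists_bend hM'
  /- 3. The phantom background: trivial motion, Schwarzschild label `(M', 0)`, radius `|y̲|`. -/
  obtain ⟨r₁, hr₁⟩ : ∃ r₁ : E4 → ℝ, r₁ = fun x ↦ Kerr.radius 0 (poincareInv 1 0 x) := ⟨_, rfl⟩
  have hr₁' : ∀ x, r₁ x = E4.spatialNorm x := fun x ↦ hr₁ ▸
    (congrArg (Kerr.radius 0) (poincareInv_one_zero' x)).trans (Kerr.radius_zero_left x)
  obtain ⟨B₁, hB₁⟩ : ∃ B₁ : ModelBackground, B₁ = starBackground 1 0 M' 0 r₁ := ⟨_, rfl⟩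
  have hB₁t (x) : B₁.time x = x 0 := by rw [hB₁, starBackground_time, poincareInv_one_zero']
  have hB₁r (x) : B₁.radius x = E4.spatialNorm x := by rw [hB₁, starBackground_radius, hr₁']
  have hB₁d : ∀ x, x ∈ B₁.domain ↔ M' < E4.spatialNorm x := fun x ↦ by
    rw [hB₁, mem_starBackground_domain, Kerr.mem_region, poincareInv_one_zero',
      Kerr.radius_zero_left, max_eq_left hM'.le]
  have hrad : ∀ z : B₁.domain, ¬B₁.radius z.1 ≤ M' := fun z ↦
    not_le.2 ((hB₁r z.1).symm ▸ (hB₁d _).1 z.2)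
  obtain ⟨L₁, hL₁⟩ : ∃ L₁ : Set B₁.domain,
      L₁ = {x | -1 < B₁.time x.1 ∧ B₁.time x.1 < 1 ∧ B₁.radius x.1 < M' + 1} := ⟨_, rfl⟩
  obtain ⟨W₁, hW₁⟩ : ∃ W₁ : Set B₁.domain,
      W₁ = {x | 0 < B₁.time x.1 ∧ B₁.time x.1 < 1 ∧ B₁.radius x.1 ≤ M'} := ⟨_, rfl⟩
  have memL₁ : ∀ z : B₁.domain, z ∈ L₁ ↔
      -1 < z.1 0 ∧ z.1 0 < 1 ∧ E4.spatialNorm z.1 < M' + 1 := fun z ↦ by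
    rw [hL₁, mem_setOf_eq, hB₁t, hB₁r]
  have srcL₁ : ∀ z : B₁.domain, z ∈ L₁ → z.1 ∈ e.source := fun z hz ↦
    have h := (memL₁ z).1 hz
    (hsrc _).2 ⟨h.1, h.2.1, (hB₁d _).1 z.2, h.2.2⟩
  -- the empty pieces: upper layer and disc of the phantom hole
  have hW₁e : W₁ = ∅ := eq_empty_of_forall_notMem fun z hz ↦ by
    rw [hW₁] at hz; exact hrad z hz.2.2
  have hT₁e : B₁.truncTimeSlab M' 0 = ∅ := eq_empty_of_forall_notMem fun z hz ↦
    hrad z (ModelBackground.mem_truncTimeSlab.1 hz).2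
  /- 4. The phantom chart `Ψ₁ = Ψ₀ ∘ π ∘ Φ`. -/
  obtain ⟨Ψ₁, hΨ₁⟩ : ∃ Ψ₁ : B₁.domain → 𝒟.carrier, Ψ₁ = fun z ↦ Ψ₀ (π (e z.1)) := ⟨_, rfl⟩
  have hmaps : ∀ z : B₁.domain, z ∈ L₁ → e z.1 ∈ (U₀ : Set E4) ∧ π (e z.1) ∈ L₀ := fun z hz ↦ by
    obtain ⟨h1, h2, -⟩ := (memL₁ z).1 hz
    have hU : e z.1 ∈ (U₀ : Set E4) := hU₀' _ (by rw [htime]; exact h1)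
    refine ⟨hU, ?_⟩
    rw [hπ _ hU, hL₀, mem_setOf_eq, hypBackground_time, htime]
    exact ⟨h1, h2⟩
  have hL₁o : IsOpen L₁ := by
    have h0c : Continuous fun z : B₁.domain ↦ z.1 0 :=
      (show Continuous fun x : E4 ↦ x 0 by fun_prop).comp continuous_subtype_val
    have hsNc : Continuous fun z : B₁.domain ↦ E4.spatialNorm z.1 :=
      E4.spatial.continuous.norm.comp continuous_subtype_val
    rw [Set.ext memL₁]
    exact (isOpen_lt continuous_const h0c).and ((isOpen_lt h0c continuous_const).and
      (isOpen_lt hsNc continuous_const))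
  -- (a) smoothness on the layer
  have hΨ₁s : ContMDiffOn 𝓘(ℝ, E4) (𝓡 4) ∞ Ψ₁ L₁ := by
    rw [hΨ₁]
    refine hΨ₀.comp (f := fun z : B₁.domain ↦ π (e z.1)) (fun z hz ↦ ?_) fun z hz ↦ (hmaps z hz).2
    refine ContMDiffAt.contMDiffWithinAt ?_
    rw [← ContMDiffAt.subtypeVal_comp_iff]
    have hev : (Subtype.val ∘ fun z : B₁.domain ↦ π (e z.1)) =ᶠ[𝓝 z] fun z ↦ e z.1 := by
      filter_upwards [hL₁o.mem_nhds hz] with w hw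
      rw [Function.comp_apply, hπ _ (hmaps w hw).1]
    refine ContMDiffAt.congr_of_eventuallyEq ?_ hev
    exact contMDiffAt_subtype_iff.2 (contMDiffAt_iff_contDiffAt.2 (hsmooth _ (srcL₁ z hz)))
  -- (b) open embedding of the layer: `Ψ₀|L₀ ∘ Θ` with `Θ : L₁ → L₀` induced by the bending map
  have hΨ₁e : IsOpenEmbedding (L₁.restrict Ψ₁) := by
    have hΘ : ∀ z : L₁, π (e z.1.1) ∈ L₀ := fun z ↦ (hmaps z.1 z.2).2
    rw [show L₁.restrict Ψ₁ = L₀.restrict Ψ₀ ∘ fun z ↦ ⟨π (e z.1.1), hΘ z⟩ from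
      funext fun z ↦ by rw [hΨ₁]; rfl]
    refine hΨ₀e.comp (IsOpenEmbedding.of_comp _
      (U₀.isOpen.isOpenEmbedding_subtypeVal.comp hL₀o.isOpenEmbedding_subtypeVal) ?_)
    have hj : IsOpenEmbedding fun z : L₁ ↦ (⟨z.1.1, srcL₁ z.1 z.2⟩ : e.source) :=
      IsOpenEmbedding.of_comp _ e.open_source.isOpenEmbedding_subtypeVal
        (B₁.domain.isOpen.isOpenEmbedding_subtypeVal.comp hL₁o.isOpenEmbedding_subtypeVal)
    convert e.isOpenEmbedding_restrict.comp hj using 1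
    funext z
    simp only [Function.comp_apply, restrict_apply]
    rw [hπ _ (hmaps z.1 z.2).1]
  -- (c) the layer is charted into `J⁺(ι X)`
  have hΨ₁J : Ψ₁ '' L₁ ⊆ 𝒟.metric.causalFuture 𝒟.timeOrientation (range 𝒟.embed) := by
    refine Subset.trans ?_ hΨ₀J
    rintro _ ⟨z, hz, rfl⟩
    exact ⟨π (e z.1), (hmaps z hz).2, by rw [hΨ₁]⟩
  -- (d) the phantom layer charts the cap `Ψ₀ {t₀ = 0, M'/2 < |x̲| < M'}` of the hyperboloid
  have hov₂ : Ψ₀ '' {x | (hypBackground U₀).time x.1 = 0 ∧ M' / 2 < r₁ x.1 ∧ r₁ x.1 < M'} ⊆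
      Ψ₁ '' L₁ := by
    rintro _ ⟨x, ⟨hx0, hx1, hx2⟩, rfl⟩
    rw [hr₁'] at hx1 hx2
    rw [hypBackground_time] at hx0
    have htg : x.1 ∈ e.target := htgt x.1 hx0 hx1 hx2
    obtain ⟨h1, h2, h3, h4⟩ := (hsrc _).1 (e.map_target htg)
    refine ⟨⟨e.symm x.1, (hB₁d _).2 h3⟩, (memL₁ _).2 ⟨h1, h2, h4⟩, ?_⟩
    rw [hΨ₁]
    dsimp only; rw [e.right_inv htg, hπ x.1 x.2]
  -- (e) the deviation on the empty disc vanishes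
  have hdev₁ : 𝒟.toSpacetime.truncDeviationCk B₁ Ψ₁ k M' 0 ≤ ε := by
    unfold Spacetime.truncDeviationCk
    rw [hT₁e, image_empty]
    simp [supCkENorm]
  have hWu : ⋃ _ : Fin 1, Ψ₁ '' W₁ = ∅ := by rw [iUnion_const, hW₁e, image_empty]
  /- 5. Assembly of the twenty clauses. -/
  refine ⟨fun _ ↦ M', fun _ ↦ M' / 2, fun _ ↦ (1, 0), fun _ ↦ r₁, fun _ ↦ B₁, U₀,
    hypBackground U₀, fun _ ↦ Ψ₁, Ψ₀, fun _ ↦ L₁, fun _ ↦ W₁, L₀, W₀, fun _ ↦ hr₁, fun _ ↦ hB₁,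
    rfl, fun _ ↦ ⟨hL₁, hW₁⟩, hL₀, hW₀,
    fun _ ↦ ⟨hM', abs_zero.le.trans hM'.le, half_pos hM', half_lt_self hM'⟩,
    fun x hx ↦ hU₀' x hx.1, fun _ ↦ ⟨hΨ₁s, hΨ₁e, hΨ₁J⟩, hΨ₀, hΨ₀e, hΨ₀J, fun _ ↦ hdev₁, hdev₀,
    Subsingleton.pairwise, fun _ ↦ ?_, fun _ ↦ hov₂, ?_, ?_, ?_⟩
  · -- the inner overlap annulus `{t* = 0, M'/2 < r ≤ M'}` of the phantom hole is empty
    rintro _ ⟨z, hz, rfl⟩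
    exact absurd hz.2.2 (hrad z)
  · rw [iUnion_const, hT₁e, image_empty, union_empty]
    exact hS
  · rw [hWu, union_empty]
    exact hWI
  · rw [hWu, union_empty]
    exact hbar

end Summit.FinalStateConjecture.FinalStateConjecture.Theorems.BartnikGapSettling.Capture
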